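import Summits.CriticalPhenomena.PercolationContinuityZ3.Theorems.SahiMasterFamilyGHBridge

/-!
# The injective polarisation `Ψ^sym` of Sahi's functional: `Ψ^sym_k ≥ 0` typed, and `Ψ^sym_k ≥ 0 ⇒ (UC-hull)_k` (the top of the ladder)

Unit `prim-masterthm-p4` (gen 16; crux anchor stmt-CriticalPhenomena-4575, helper work; memo
`run/shared/lean/prim/prim-masterthm/prim-masterthm-p4/P4-GEN16-REPORT.md` §5–§6; gen 15 P4-GEN15-REPORT §8).  Companion of `…GHConjecture`
(`UCHullNonneg k`, `GSystemNonneg k`) and `…GHBridge` / `…GHConverse` (`PCNonneg k`, `(GH)_k ⟺ PC-k`).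

* `polar n γ` — the INJECTIVE POLARISATION of `Φ_n`: for `n` set functions `γ_0,…,γ_{n−1}`,
  `P_n(γ) = Σ_{π ⊢ [n]} (−1)^{|π|−1} · avg_{ι : π ↪ [n]} ∏_{B∈π} (|B|−1)!·γ_{ι(B)}(B)` (average over INJECTIVE assignments of blocks to arguments).
  `polar_diag`: `P_n(β,…,β) = Φ_n(β)`; `phiSet_mixture_eq`: for a mixture `β = Σ_x w_x v_x` (`Σ w = 1`),
  **`Φ_n(β) = Σ_{g : [n] → X} (∏_r w_{g r}) · P_n(v_{g 0},…,v_{g (n−1)})`** (multilinearity; `sum_prod_mul_prod_comp_emb` is the one-line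
  probabilistic fact "restricting an i.i.d. assignment along an injection is i.i.d.").
* `PsiSymNonneg n` — **CONJECTURE Ψ^sym**: `P_n(1_{V_0},…,1_{V_{n−1}}) ≥ 0` for every n-tuple of union-closed families containing `univ`
  (conjecture-valued definition; VERIFIED EXHAUSTIVELY for n = 4 — all 1.93·10^12 tuples of the 2 271 families, kit j137681/j138210 — and by
  sampling for n = 5, 6; equivalently `P_n ≥ 0` on `P_UC(n)^n`).
* **`ucHullNonneg_of_psiSymNonneg : PsiSymNonneg n → UCHullNonneg n`** (hence `→ GSystemNonneg n → PCNonneg n`): the ladder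
  `Ψ^sym ⇒ (UC-hull) ⇒ (GH) ⟺ PC` is now entirely in the kernel.
HONEST FRAMING: `PsiSymNonneg n` is OPEN for every `n ≥ 5` as a theorem (n = 4 is a finite computation not replayed in Lean); Sahi's `C_k`, (GH)_k =
PC-k (k ≥ 8) and the master theorem remain OPEN.  Axioms standard. [this work]
-/

noncomputable section

open scoped Classical

namespace Summit.CriticalPhenomena.PercolationContinuityZ3.Theorems

namespace PsiSym

open Finset
open Literature.Combinatorics.Sahi2008
open PrincipalCapBeta (phiSet)

variable {n : ℕ}

/-- **The injective polarisation of `Φ_n`** (average over embeddings of the blocks into the `n` argument slots). [this work] -/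
def polar (n : ℕ) (γ : Fin n → Finset (Fin n) → ℝ) : ℝ :=
  ∑ c : OrderedFinpartition n, (-1 : ℝ) ^ (c.length - 1) *
    ((∑ e : (Fin c.length ↪ Fin n), ∏ j : Fin c.length, (((c.partSize j - 1).factorial : ℝ) * γ (e j) (PartitionForm.block c j))) /
      (Fintype.card (Fin c.length ↪ Fin n) : ℝ))

/-- There are embeddings of the blocks into the slots (`|π| ≤ n`), so the averaging denominator is positive. [this work] -/
theorem card_emb_pos (c : OrderedFinpartition n) : 0 < (Fintype.card (Fin c.length ↪ Fin n) : ℝ) := by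
  exact_mod_cast Fintype.card_pos_iff.2 ⟨Fin.castLEEmb c.length_le⟩

/-- **On the diagonal the polarisation is `Φ_n`**: `P_n(β,…,β) = Φ_n(β)`. [this work] -/
theorem polar_diag (β : Finset (Fin n) → ℝ) : polar n (fun _ => β) = phiSet n β := by
  unfold polar PrincipalCapBeta.phiSet
  refine sum_congr rfl fun c _ => ?_
  rw [sum_const, card_univ, nsmul_eq_mul, mul_div_cancel_left₀ _ (card_emb_pos c).ne']

/-- **"Restricting an i.i.d. assignment along an injection is i.i.d."**: for an embedding `e : α ↪ β`, weights `w` summing to one and any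
`F`, `Σ_{g : β → X} (∏_b w(g b))·∏_a F_a(g(e a)) = ∏_a Σ_x w_x F_a(x)`. [this work] -/
theorem sum_prod_mul_prod_comp_emb {α β X : Type*} [Fintype α] [Fintype β] [Fintype X] [DecidableEq β] (e : α ↪ β) (w : X → ℝ)
    (hw : ∑ x, w x = 1) (F : α → X → ℝ) :
    ∑ g : β → X, (∏ b, w (g b)) * ∏ a, F a (g (e a)) = ∏ a, ∑ x, w x * F a x := by
  -- regroup the factors `F a` along the fibres of `e`
  set H : β → X → ℝ := fun b x => ∏ a ∈ univ.filter (fun a => e a = b), F a x with hH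
  have hfib : ∀ g : β → X, (∏ a, F a (g (e a))) = ∏ b, H b (g b) := by
    intro g
    rw [hH]
    simp only
    rw [← prod_fiberwise univ e fun a => F a (g (e a))]
    refine prod_congr rfl fun b _ => prod_congr rfl fun a ha => ?_
    rw [(mem_filter.1 ha).2]
  have h1 : ∑ g : β → X, (∏ b, w (g b)) * ∏ a, F a (g (e a)) = ∑ g : β → X, ∏ b, (w (g b) * H b (g b)) := by
    refine sum_congr rfl fun g _ => ?_
    rw [hfib g, prod_mul_distrib]
  rw [h1]
  have h2 : ∑ g : β → X, ∏ b, (w (g b) * H b (g b)) = ∏ b, ∑ x, w x * H b x := by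
    rw [prod_univ_sum (fun _ => (univ : Finset X)) fun b x => w x * H b x, Fintype.piFinset_univ]
  rw [h2]
  -- off the range of `e` the factor is `Σ_x w_x = 1`; on the range it is the wanted factor
  have hoff : ∀ b, b ∉ univ.map e → ∑ x, w x * H b x = 1 := by
    intro b hb
    have hfilt : univ.filter (fun a => e a = b) = ∅ := by
      rw [filter_eq_empty_iff]
      intro a _ hab
      exact hb (mem_map.2 ⟨a, mem_univ a, hab⟩)
    simp only [hH, hfilt, prod_empty, mul_one, hw]
  rw [← prod_subset (subset_univ (univ.map e)) fun b _ hb => hoff b hb, prod_map]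
  refine prod_congr rfl fun a _ => sum_congr rfl fun x _ => ?_
  have hfilt : univ.filter (fun a' => e a' = e a) = {a} := by
    ext a'
    simp only [mem_filter, mem_univ, true_and, mem_singleton]
    exact ⟨fun h => e.injective h, fun h => by rw [h]⟩
  show w x * H (e a) x = w x * F a x
  simp only [hH, hfilt, prod_singleton]

/-- **MULTILINEAR EXPANSION of `Φ_n` at a mixture**: if `β = Σ_x w_x v_x` with `Σ_x w_x = 1`, then
`Φ_n(β) = Σ_{g : [n] → X} (∏_r w_{g r})·P_n(v_{g 0},…,v_{g (n−1)})`. [this work] -/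
theorem phiSet_mixture_eq {X : Type*} [Fintype X] (w : X → ℝ) (hw : ∑ x, w x = 1) (v : X → Finset (Fin n) → ℝ) :
    phiSet n (fun S => ∑ x, w x * v x S) = ∑ g : Fin n → X, (∏ r, w (g r)) * polar n (fun r => v (g r)) := by
  -- bring the sum over `g` inside the sum over set partitions
  have hR : ∑ g : Fin n → X, (∏ r, w (g r)) * polar n (fun r => v (g r)) =
      ∑ c : OrderedFinpartition n, ∑ g : Fin n → X, (∏ r, w (g r)) * ((-1 : ℝ) ^ (c.length - 1) *
        ((∑ e : (Fin c.length ↪ Fin n), ∏ j, (((c.partSize j - 1).factorial : ℝ) * v (g (e j)) (PartitionForm.block c j))) /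
          (Fintype.card (Fin c.length ↪ Fin n) : ℝ))) := by
    unfold polar
    simp_rw [mul_sum]
    rw [sum_comm]
  rw [hR]
  unfold PrincipalCapBeta.phiSet
  refine sum_congr rfl fun c _ => ?_
  set N : ℝ := (Fintype.card (Fin c.length ↪ Fin n) : ℝ) with hNdef
  have hN : N ≠ 0 := (card_emb_pos (n := n) c).ne'
  set s : ℝ := (-1 : ℝ) ^ (c.length - 1) with hs
  set T : (Fin c.length ↪ Fin n) → (Fin n → X) → ℝ :=
    fun e g => ∏ j, (((c.partSize j - 1).factorial : ℝ) * v (g (e j)) (PartitionForm.block c j)) with hT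
  -- the inner sum over assignments `g`, for a fixed embedding `e`
  have hinner : ∀ e : (Fin c.length ↪ Fin n), ∑ g : Fin n → X, (∏ r, w (g r)) * T e g =
      ∏ j, (((c.partSize j - 1).factorial : ℝ) * ∑ x, w x * v x (PartitionForm.block c j)) := by
    intro e
    rw [hT]
    simp only
    rw [sum_prod_mul_prod_comp_emb e w hw fun j x => ((c.partSize j - 1).factorial : ℝ) * v x (PartitionForm.block c j)]
    refine prod_congr rfl fun j _ => ?_
    rw [mul_sum]
    exact sum_congr rfl fun x _ => by ring
  have e1 : ∀ g : Fin n → X, (∏ r, w (g r)) * (s * ((∑ e, T e g) / N)) = (s / N) * ∑ e, (∏ r, w (g r)) * T e g := by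
    intro g
    rw [← mul_sum]
    ring
  beta_reduce
  symm
  show ∑ g : Fin n → X, (∏ r, w (g r)) * (s * ((∑ e, T e g) / N)) =
    s * ∏ j, (((c.partSize j - 1).factorial : ℝ) * ∑ x, w x * v x (PartitionForm.block c j))
  rw [sum_congr rfl fun g _ => e1 g, ← mul_sum, sum_comm, sum_congr rfl fun e _ => hinner e, sum_const, card_univ,
    nsmul_eq_mul, ← hNdef, ← mul_assoc, div_mul_cancel₀ s hN]

/-- **CONJECTURE Ψ^sym** (the top of the ladder): the injective polarisation of `Φ_n` is nonnegative at every `n`-tuple of union-closed families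
containing `univ`.  A conjecture-valued definition, never a fact; verified exhaustively for `n = 4` (kit j137681), sampled for `n = 5, 6`. [this work]
[status: open for n ≥ 5 (n = 4: finite computation)] -/
@[conjecture] def PsiSymNonneg (n : ℕ) : Prop :=
  ∀ V : Fin n → Finset (Finset (Fin n)), (∀ r, ∀ A ∈ V r, ∀ A' ∈ V r, A ∪ A' ∈ V r) → (∀ r, univ ∈ V r) →
    0 ≤ polar n (fun r S => if S ∈ V r then (1 : ℝ) else 0)

/-- **`Ψ^sym_n ≥ 0 ⇒ (UC-hull)_n`**: a mixture of union-closed indicator functions expands, by multilinearity, into a nonnegative combination of values of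
`Ψ^sym` at tuples of the families. [this work] -/
theorem ucHullNonneg_of_psiSymNonneg (h : PsiSymNonneg n) : GHConjecture.UCHullNonneg n := by
  intro α _ w 𝒰 hw0 hw1 hUC htop
  rw [phiSet_mixture_eq w hw1 fun x S => if S ∈ 𝒰 x then (1 : ℝ) else 0]
  exact sum_nonneg fun g _ => mul_nonneg (prod_nonneg fun r _ => hw0 _) (h (fun r => 𝒰 (g r)) (fun r => hUC (g r)) fun r => htop (g r))

/-- Down the ladder: `Ψ^sym_n ≥ 0 ⇒ (GH)_n`. [this work] -/
theorem gSystemNonneg_of_psiSymNonneg (h : PsiSymNonneg n) : GHConjecture.GSystemNonneg n :=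
  GHConjecture.gSystemNonneg_of_ucHullNonneg (ucHullNonneg_of_psiSymNonneg h)

/-- Down the ladder: `Ψ^sym_n ≥ 0 ⇒` PC-n (Sahi's `C_n` on the principal-cap stratum). [this work] -/
theorem pcNonneg_of_psiSymNonneg (h : PsiSymNonneg n) : GHBridge.PCNonneg n :=
  GHBridge.pcNonneg_of_ucHullNonneg (ucHullNonneg_of_psiSymNonneg h)

end PsiSym

end Summit.CriticalPhenomena.PercolationContinuityZ3.Theorems
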